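import Summits.BirchSwinnertonDyer.BirchSwinnertonDyer.Theorems.KatoDescentPotSupersingularKatoFiniteLevelStrictTamagawa
import Literature.NumberTheory.EllipticCurves.PAdicBSDKatoFiniteProofs
import Literature.NumberTheory.EllipticCurves.LeadingTermPPartProofs
import HarnessLib

/-!
# Kato's (14.9.3) at finite level, part 12: the bound in the ITEM'S vocabulary — rank `0` (`E(K)` finite) and `Ш(E/K)[p^∞]`
# finite: `#H¹_ℛ(K, E[p^k]) ≤ #Ш(E/K)[p^∞] · ∏_{v∈T∖P} #H¹_ur(K_v, E[p^∞]) · ∏_{v∈P} #𝓚_v` for `k ≥ k₀`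
# (route `KatoDescentPotSupersingular` / `…Tame…`, crux M = stmt-BirchSwinnertonDyer-19196 `ReducibleKatoMember`; route-free helper)

Seat `bsd-potss-rkm` g17 (prover; cell `bsd-potss`), item stmt-BirchSwinnertonDyer-19196 (`--supports … --as helper`; closes
nothing).  HONEST FRAMING: BSD is not proved by any of this; nothing is booked; theorems only (no definition, no named fact).
The item's conclusion is an inequality for `ord_p #Ш(W')[p^∞] + v_p(Tam W')` against `ord_p(L(W',1)/Ω) + 3·ord_p #W'(ℚ)_tors`;
this file puts the KERNEL half of Kato's proof of Prop. 14.16 (2) in that vocabulary: with `E(K)` finite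
(`[Finite W.toAffine.Point]`, rank `0`) and `Ш(E/K)[p^∞]` finite, `Sel_{p^∞}(E/K)` is finite and has the order of `Ш(E/K)[p^∞]`
(tree theorems `finite_selmerGroupPInfty_of_finite_primaryComponent`, `natCard_selmerGroupPInfty_eq_natCard_primaryComponent_sha`,
Greenberg LNM 1716 §1–2), so parts 9–11 give

* **`natCard_selmerGroup_strict_le_sha_mul_prod`** — `#Sel_str^{ur}(K,E[p^∞]) ≤ #Ш(E/K)[p^∞] · ∏_{v∈T∖P} #H¹_ur(K_v,E[p^∞])`;
* **`exists_forall_le_natCard_selmerGroup_relaxed_le_sha_intPow`** (any `K : Type`) and **`…_rat_…`** (`K = ℚ`, `P = {v_p}`):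
  `∃ k₀ ∀ k ≥ k₀`, every Poitou–Tate family at level `p^k`, every Kato pair `𝓢 ≤ ℛ` on `W.torsionGaloisModule ((p:ℤ)^k)`:
  `#H¹_ℛ(K,E[p^k]) ≤ #Ш(E/K)[p^∞] · ∏_{v∈T∖P} #H¹_ur(K_v,E[p^∞]) · ∏_{v∈P} #𝓚_v`
  (over `ℚ`: `… · ∏_{ℓ∈T∖{v_p}} #H¹_ur(ℚ_ℓ,E[p^∞]) · (#E(ℚ_p)[p^k] · p^k)`).
  What is NOT here: `#H¹_ur(ℚ_ℓ,E[p^∞]) = c_ℓ^{(p)}` (Néron components) and the compact half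
  `A/(A ∩ p^k H¹(ℚ,T_pE)) ↪ H¹_ℛ(ℚ,E[p^k])` feeding `L(E,1)/Ω` — constructions outside this file.

References: K. Kato, Astérisque 295 (2004) §14.8, (14.9.3), Prop. 14.16 (2) [Kato2004Asterisque]; R. Greenberg, LNM 1716 (1999) §1–4
[Greenberg1999LNM].
-/

-- the summit and its single problem are both named `BirchSwinnertonDyer` (registry layout D-0017)
set_option linter.dupNamespace false
set_option autoImplicit false

noncomputable section

open scoped Classical ContRepresentation NumberField
open Function Field NumberField IsDedekindDomain WeierstrassCurve
open Literature.NumberTheory.EllipticCurves Literature.NumberTheory.GaloisRepresentations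
  Literature.NumberTheory.GaloisRepresentations.DiscreteGaloisModule Literature.NumberTheory.GaloisCohomology
open Literature.NumberTheory.EllipticCurves.Kato2004
open Summit.BirchSwinnertonDyer.Rank1Residual.X11b.LocBridge

namespace Summit.BirchSwinnertonDyer.BirchSwinnertonDyer.Theorems.KatoFiniteLevelCount

section Sha

variable {K : Type} [Field K] [NumberField K] (W : WeierstrassCurve K) [W.IsElliptic] (p : ℕ) [Fact p.Prime]

/-- The local factor at `v_p` in the `Kato2004` level dialect: `#𝓚_{v_p}(E[p^k]) = #E(ℚ_{v_p})[p^k] · p^k`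
(part 7 `natCard_kummerSelmerStructure_primePlace` along `Nat.cast_pow`). [cite: MilneADT2006, I Lemma 3.3] -/
theorem natCard_kummerSelmerStructure_primePlace_intPow (W : WeierstrassCurve ℚ) [W.IsElliptic] (k : ℕ) :
    Nat.card (W.kummerSelmerStructure ((p : ℤ) ^ k) (Sum.inr (primePlace p))) =
      Nat.card (nsmulAddMonoidHom (p ^ k) :
          (W.baseChange ((primePlace p).adicCompletion ℚ)).toAffine.Point →+ _).ker * p ^ k := by
  rw [← Nat.cast_pow]
  exact natCard_kummerSelmerStructure_primePlace W p k

/-- **`#Sel_str^{ur}(K,E[p^∞]) ≤ #Ш(E/K)[p^∞] · ∏_{v∈T∖P} #H¹_ur(K_v, E[p^∞])`** in rank `0` (`E(K)` finite) with `Ш(E/K)[p^∞]`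
finite: part 11 and `#Sel_{p^∞}(E/K) = #Ш(E/K)[p^∞]` (Greenberg LNM 1716 §1–2, tree theorems).
[cite: Kato2004Asterisque, §14.8 (p. 238)] [cite: Greenberg1999LNM, §1 p. 54 and §2 pp. 62–63] -/
theorem natCard_selmerGroup_strict_le_sha_mul_prod (hodd : p ≠ 2) (P T : Finset (HeightOneSpectrum (𝓞 K)))
    (hPT : P ⊆ T) (hT : ∀ v : HeightOneSpectrum (𝓞 K), v ∉ T → (p : 𝓞 K) ∉ v.asIdeal ∧ W.HasGoodReductionAt v)
    (hPp : ∀ v : HeightOneSpectrum (𝓞 K), (p : 𝓞 K) ∈ v.asIdeal → v ∈ P)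
    (𝓢inf 𝓢zero : SelmerStructure (primaryGaloisModule W p)) [Finite W.toAffine.Point]
    [Finite (AddCommGroup.primaryComponent W.sha p)]
    (hIP : ∀ v ∈ P, 𝓢inf (Sum.inr v) = ⊥)
    (hIur : ∀ v ∉ P, 𝓢inf (Sum.inr v) = unramifiedSubgroup (GaloisRep.toLocal v (primaryGaloisModule W p)) 1)
    (h0T : ∀ v ∈ T, 𝓢zero (Sum.inr v) = ⊥)
    (h0ur : ∀ v ∉ T, 𝓢zero (Sum.inr v) = unramifiedSubgroup (GaloisRep.toLocal v (primaryGaloisModule W p)) 1)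
    (h0inl : ∀ w : InfinitePlace K, 𝓢zero (Sum.inl w) = ⊤) :
    Nat.card 𝓢inf.selmerGroup ≤
      Nat.card (AddCommGroup.primaryComponent W.sha p) *
        ∏ v ∈ T \ P, Nat.card (unramifiedSubgroup (GaloisRep.toLocal v (primaryGaloisModule W p)) 1) := by
  haveI : Finite (W.selmerGroupPInfty p) := W.finite_selmerGroupPInfty_of_finite_primaryComponent p
  rw [← W.natCard_selmerGroupPInfty_eq_natCard_primaryComponent_sha p]
  exact natCard_selmerGroup_strict_le_selmerGroupPInfty_mul_prod W p hodd P T hPT hT hPp 𝓢inf 𝓢zero hIP hIur h0T h0ur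
    h0inl

/-- **Kato's Prop. 14.16 (2) shape at finite level, rank `0`, any `K : Type`**: for `k ≥ k₀`, every Poitou–Tate family at
level `p^k`, every Kato pair `𝓢 ≤ ℛ` on `W.torsionGaloisModule ((p:ℤ)^k)`:
**`#H¹_ℛ(K, E[p^k]) ≤ #Ш(E/K)[p^∞] · ∏_{v∈T∖P} #H¹_ur(K_v, E[p^∞]) · ∏_{v∈P} #𝓚_v`**.
[cite: Kato2004Asterisque, §14.8 (p. 238), (14.9.3) (p. 240), Prop. 14.16 (2) (p. 244)] -/
theorem exists_forall_le_natCard_selmerGroup_relaxed_le_sha_intPow (hodd : p ≠ 2)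
    (P T : Finset (HeightOneSpectrum (𝓞 K)))
    (hPT : P ⊆ T) (hT : ∀ v : HeightOneSpectrum (𝓞 K), v ∉ T → (p : 𝓞 K) ∉ v.asIdeal ∧ W.HasGoodReductionAt v)
    (hPp : ∀ v : HeightOneSpectrum (𝓞 K), (p : 𝓞 K) ∈ v.asIdeal → v ∈ P)
    (𝓢inf 𝓢zero : SelmerStructure (primaryGaloisModule W p)) [Finite W.toAffine.Point]
    [Finite (AddCommGroup.primaryComponent W.sha p)]
    (hIP : ∀ v ∈ P, 𝓢inf (Sum.inr v) = ⊥)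
    (hIur : ∀ v ∉ P, 𝓢inf (Sum.inr v) = unramifiedSubgroup (GaloisRep.toLocal v (primaryGaloisModule W p)) 1)
    (hIinl : ∀ w : InfinitePlace K, 𝓢inf (Sum.inl w) = ⊤)
    (h0T : ∀ v ∈ T, 𝓢zero (Sum.inr v) = ⊥)
    (h0ur : ∀ v ∉ T, 𝓢zero (Sum.inr v) = unramifiedSubgroup (GaloisRep.toLocal v (primaryGaloisModule W p)) 1)
    (h0inl : ∀ w : InfinitePlace K, 𝓢zero (Sum.inl w) = ⊤) {v₀ : HeightOneSpectrum (𝓞 K)} (hv₀P : v₀ ∈ P) :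
    ∃ k₀ : ℕ, ∀ k, k₀ ≤ k →
      ∀ (inv : LocalInvariants K (p ^ k)), inv.IsPerfect → inv.SumLocalTermEqZero → inv.SelmerComplement →
      ∀ (𝓢 ℛ : SelmerStructure (W.torsionGaloisModule ((p : ℤ) ^ k))),
        (∀ v ∈ P, 𝓢 (Sum.inr v) = ⊥) → (∀ v ∈ P, ℛ (Sum.inr v) = ⊤) →
        (∀ v ∉ P, 𝓢 (Sum.inr v) = unramifiedSubgroup (GaloisRep.toLocal v (W.torsionGaloisModule ((p : ℤ) ^ k))) 1) →
        (∀ v ∉ P, ℛ (Sum.inr v) = unramifiedSubgroup (GaloisRep.toLocal v (W.torsionGaloisModule ((p : ℤ) ^ k))) 1) →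
        Nat.card ℛ.selmerGroup ≤
          Nat.card (AddCommGroup.primaryComponent W.sha p) *
            (∏ v ∈ T \ P, Nat.card (unramifiedSubgroup (GaloisRep.toLocal v (primaryGaloisModule W p)) 1)) *
            ∏ v ∈ P, Nat.card (W.kummerSelmerStructure ((p : ℤ) ^ k) (Sum.inr v)) := by
  haveI : Finite (W.selmerGroupPInfty p) := W.finite_selmerGroupPInfty_of_finite_primaryComponent p
  rw [← W.natCard_selmerGroupPInfty_eq_natCard_primaryComponent_sha p]
  exact exists_forall_le_natCard_selmerGroup_relaxed_le_intPow W p hodd P T hPT hT hPp 𝓢inf 𝓢zero hIP hIur hIinl h0T h0ur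
    h0inl hv₀P

/-- **Kato's Prop. 14.16 (2) shape at finite level over `ℚ`, rank `0`**: `E/ℚ` with `E(ℚ)` finite and `Ш(E/ℚ)[p^∞]` finite,
`p` odd, `T ∋ v_p` with good reduction outside, Kato's strict structure `𝓢∞` (zero at `v_p`, unramified at every other prime)
and `𝓢⁰` (zero on `T`, unramified outside): for `k ≥ k₀`, every Poitou–Tate family at level `p^k`, every Kato pair `𝓢 ≤ ℛ`
on `W.torsionGaloisModule ((p:ℤ)^k)`:
**`#H¹_ℛ(ℚ, E[p^k]) ≤ #Ш(E/ℚ)[p^∞] · ∏_{ℓ ∈ T∖{v_p}} #H¹_ur(ℚ_ℓ, E[p^∞]) · (#E(ℚ_p)[p^k] · p^k)`**.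
[cite: Kato2004Asterisque, §14.8 (p. 238), (14.9.3) (p. 240), Prop. 14.16 (2) (p. 244)] -/
theorem exists_forall_le_natCard_selmerGroup_relaxed_le_sha_rat_intPow (W : WeierstrassCurve ℚ) [W.IsElliptic]
    (hodd : p ≠ 2) (T : Finset (HeightOneSpectrum (𝓞 ℚ))) (hpT : primePlace p ∈ T)
    (hT : ∀ v : HeightOneSpectrum (𝓞 ℚ), v ∉ T → W.HasGoodReductionAt v)
    (𝓢inf 𝓢zero : SelmerStructure (primaryGaloisModule W p)) [Finite W.toAffine.Point]
    [Finite (AddCommGroup.primaryComponent W.sha p)]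
    (hIP : 𝓢inf (Sum.inr (primePlace p)) = ⊥)
    (hIur : ∀ v : HeightOneSpectrum (𝓞 ℚ), v ≠ primePlace p →
      𝓢inf (Sum.inr v) = unramifiedSubgroup (GaloisRep.toLocal v (primaryGaloisModule W p)) 1)
    (hIinl : ∀ w : InfinitePlace ℚ, 𝓢inf (Sum.inl w) = ⊤)
    (h0T : ∀ v ∈ T, 𝓢zero (Sum.inr v) = ⊥)
    (h0ur : ∀ v ∉ T, 𝓢zero (Sum.inr v) = unramifiedSubgroup (GaloisRep.toLocal v (primaryGaloisModule W p)) 1)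
    (h0inl : ∀ w : InfinitePlace ℚ, 𝓢zero (Sum.inl w) = ⊤) :
    ∃ k₀ : ℕ, ∀ k, k₀ ≤ k →
      ∀ (inv : LocalInvariants ℚ (p ^ k)), inv.IsPerfect → inv.SumLocalTermEqZero → inv.SelmerComplement →
      ∀ (𝓢 ℛ : SelmerStructure (W.torsionGaloisModule ((p : ℤ) ^ k))),
        𝓢 (Sum.inr (primePlace p)) = ⊥ → ℛ (Sum.inr (primePlace p)) = ⊤ →
        (∀ v : HeightOneSpectrum (𝓞 ℚ), v ≠ primePlace p →
          𝓢 (Sum.inr v) = unramifiedSubgroup (GaloisRep.toLocal v (W.torsionGaloisModule ((p : ℤ) ^ k))) 1) →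
        (∀ v : HeightOneSpectrum (𝓞 ℚ), v ≠ primePlace p →
          ℛ (Sum.inr v) = unramifiedSubgroup (GaloisRep.toLocal v (W.torsionGaloisModule ((p : ℤ) ^ k))) 1) →
        Nat.card ℛ.selmerGroup ≤
          Nat.card (AddCommGroup.primaryComponent W.sha p) *
            (∏ v ∈ T \ {primePlace p}, Nat.card (unramifiedSubgroup (GaloisRep.toLocal v (primaryGaloisModule W p)) 1)) *
            (Nat.card (nsmulAddMonoidHom (p ^ k) :
              (W.baseChange ((primePlace p).adicCompletion ℚ)).toAffine.Point →+ _).ker * p ^ k) := by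
  have hmemP : ∀ v : HeightOneSpectrum (𝓞 ℚ), v ∈ ({primePlace p} : Finset _) ↔ v = primePlace p := fun v =>
    Finset.mem_singleton
  obtain ⟨k₀, hk₀⟩ := exists_forall_le_natCard_selmerGroup_relaxed_le_sha_intPow W p hodd {primePlace p} T
    (Finset.singleton_subset_iff.2 hpT)
    (fun v hv => ⟨natCast_not_mem_of_ne_primePlace p (fun h => hv (h ▸ hpT)), hT v hv⟩)
    (fun v hv => (hmemP v).2 (eq_primePlace_of_natCast_mem p hv)) 𝓢inf 𝓢zero
    (fun v hv => by rw [(hmemP v).1 hv]; exact hIP)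
    (fun v hv => hIur v (fun h => hv ((hmemP v).2 h))) hIinl h0T h0ur h0inl ((hmemP _).2 rfl)
  refine ⟨k₀, fun k hk inv hperf hsum hcompl 𝓢 ℛ h𝓢P hℛP h𝓢ur hℛur => ?_⟩
  have h := hk₀ k hk inv hperf hsum hcompl 𝓢 ℛ (fun v hv => by rw [(hmemP v).1 hv]; exact h𝓢P)
    (fun v hv => by rw [(hmemP v).1 hv]; exact hℛP) (fun v hv => h𝓢ur v (fun h => hv ((hmemP v).2 h)))
    (fun v hv => hℛur v (fun h => hv ((hmemP v).2 h)))
  rw [Finset.prod_singleton, natCard_kummerSelmerStructure_primePlace_intPow] at h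
  exact h

end Sha

end Summit.BirchSwinnertonDyer.BirchSwinnertonDyer.Theorems.KatoFiniteLevelCount

end
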